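import Literature.NumberTheory.LFunctions.WeilExplicitLClass
import Literature.NumberTheory.LFunctions.WeilExplicitRightEdge
import Literature.Analysis.SpecialFunctions.DigammaLogBound
import HarnessLib

/-!
# The Weil quadratic functional of a holomorphic newform (weight `k`, level `N`), AS PRINTED
# (arXiv:1412.2990 Prop. 2.1 = Mestre 1986 §I.2/§II.2 = IK Thm 5.12 with (5.86)), and its prime-free window

Cell `rh-explicit`, P-1 «A2-ext» typing (lead R7-1 (2): «Γ_ℂ archimedean term + conductor term as ONE
def», weil-grh-1; producer rh-explicit-moll-step0-2, GL2-EXT-PROTOCOL.md §1 (Q-GL2)).  Builds on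
`WeilExplicitLClass.lean` (the IK §5.1 datum).

AS PRINTED (P. Lebacque, A. Zykin(?), arXiv:1412.2990, Prop. 2.1 [paper:arxiv-1412.2990 p0004:L28–43],
restating Mestre, Compositio Math. 58 (1986) §I.2/§II.2): for `f` a primitive form of level `N`, weight
`k`, `F` even real admissible, `Φ(s) = ∫ F(x)e^{(s-1/2)x}dx`:
`Σ_{L_f(ρ)=0} Φ(ρ) = − Σ_{p,m} b(p^m)(F(m log p) + F(−m log p)) (log p) p^{−m/2} + F(0)(log N − 2 log 2π)
   + (1/π) ∫ ½[Φ(½+it) + Φ(½−it)] ψ(k/2 + it) dt`,  `ψ = Γ′/Γ`,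
`b(p^m) = a_p^m` if `p ∣ N`, `= α_p^m + ᾱ_p^m` otherwise.  With `F = h = g ⋆ g̃` (so
`½[Φ(½+it)+Φ(½−it)]ψ` symmetrises to `ĥ(½+it) Re ψ(k/2+it)`, `ĥ(½+it) = |ĝ(½+it)|²`) this is the
producer's
`Q_f(g) := (log N − 2 log 2π)·h(0) + (1/2π) ∫ ĥ(½+iτ)·2 Re ψ(k/2 + iτ) dτ − Σ_n n^{−1/2}(Λ_f(n) h(log n) + conj Λ_f(n) h(−log n))`,
`Λ_f(p^m) = b(p^m) log p` — typed here VERBATIM as `weilQuadraticGL2 k N Λf g` (the coefficient function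
`Λf : ℕ → ℂ` is a parameter: the tree has no modular-form `L`-function object yet).

PROVED: (1) the holomorphic datum `weilLDatumHolomorphic k N Λf` (`d = 2`, `κ = ((k−1)/2, (k+1)/2)`,
IK (5.86): `γ(f,s) = π^{−s}Γ((s+(k−1)/2)/2)Γ((s+(k+1)/2)/2) = c_k(2π)^{−s}Γ(s+(k−1)/2)`) has
`archDensity(t) = Re ψ(k/4 + it/2) + Re ψ(k/4 + 1/2 + it/2) = 2 Re ψ(k/2 + it) − 2 log 2` (duplication,
the tree's `digamma_add_digamma_add_half`; the `Γ_ℂ` form); (2) **`weilQuadraticGL2 k N Λf g =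
(weilLDatumHolomorphic k N Λf).functional (g ⋆ g̃)`** for every test function `g` and `k ≥ 1` — the printed
(Q-GL2) IS the IK-datum functional (Fourier inversion `∫ ĥ(½+it) dt = 2π h(0)`, `integral_weilMellin_vertical`,
moves the `−2 log 2` out of the integral); (3) the PRIME-FREE WINDOW closed form (`2a ≤ log 2`,
`Λf(0) = Λf(1) = 0`): `Re Q_f(g) = ‖g‖₂²(log N − 2 log 2π) + (1/π) ∫ |ĝ(½+it)|² Re ψ(k/2 + it) dt` — the
STAGE-1 object of P-1 (one number per `(k, N)`; the producer's certificate
`EXTREMALS/GL2-ext/base-rung-log2half-CERT` bounds the integral term below).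
Also (generic datum, namespace `WeilLDatum`): `archIntegral_weilConv_weilReflect`,
`re_functional_weilConv_weilReflect_of_tsupport_subset`, `positivityOn_iff_of_prime_free` (prime-free
window closed form for ANY datum with `Λ_f(0) = Λ_f(1) = 0`).
NOT typed: the x-space form `2ψ(k/2)h(0) + J_k(h)` of the archimedean term (the producer's Lemma X; an
identity of Gauss-integral type, to be proved in a sibling file if wanted) and any statement about the
zeros of an actual modular-form `L`-function (no such object in the tree).
-/

noncomputable section

open Complex Filter Set MeasureTheory
open scoped Real Topology ComplexConjugate

namespace Literature.NumberTheory.LFunctions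

/-! ## Generic datum: the prime-free window -/

namespace WeilLDatum

variable (D : WeilLDatum) {g : ℝ → ℂ}

/-- The archimedean integral of the datum at `g ⋆ g̃` is the real number
`∫ |ĝ(1/2+it)|² archDensity(t) dt`. [cite: IwaniecKowalski2004, §5.5 Thm 5.12 (5.45) (γ′/γ term at g ⋆ g̃)] -/
theorem archIntegral_weilConv_weilReflect (hg : IsWeilTest g) :
    (∫ t : ℝ, weilMellin (weilConv g (weilReflect g)) (1 / 2 + t * I) * (D.archDensity t : ℂ)) =
      ((∫ t : ℝ, ‖weilMellin g (1 / 2 + t * I)‖ ^ 2 * D.archDensity t : ℝ) : ℂ) := by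
  rw [← integral_complex_ofReal]
  congr 1 with t
  rw [weilMellin_weilConv_weilReflect_half hg]
  push_cast
  ring

/-- **Prime-free window, general datum**: if `Λ_f(0) = Λ_f(1) = 0`, `supp g ⊆ [-a, a]` and
`2a ≤ log 2`, then
`Re W_f(g ⋆ g̃) = ‖g‖₂² (log q − d log π) + (1/2π) ∫ |ĝ(1/2+it)|² archDensity(t) dt`.
[cite: IwaniecKowalski2004, §5.5 Thm 5.12 (5.45) (no prime power below 2)] -/
theorem re_functional_weilConv_weilReflect_of_tsupport_subset (h0 : D.vonMangoldt 0 = 0)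
    (h1 : D.vonMangoldt 1 = 0) (hg : IsWeilTest g) {a : ℝ} (hsupp : tsupport g ⊆ Icc (-a) a)
    (ha : 2 * a ≤ Real.log 2) :
    (D.functional (weilConv g (weilReflect g))).re =
      (∫ t : ℝ, ‖g t‖ ^ 2) * (Real.log D.conductor - D.degree * Real.log π) +
        1 / (2 * π) * ∫ t : ℝ, ‖weilMellin g (1 / 2 + t * I)‖ ^ 2 * D.archDensity t := by
  have hk : IsWeilTest (weilConv g (weilReflect g)) := hg.weilConv hg.weilReflect
  have hsub : tsupport (weilConv g (weilReflect g)) ⊆ Icc (-Real.log 2) (Real.log 2) :=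
    (tsupport_weilConv_weilReflect_subset hg.2 hsupp).trans (Icc_subset_Icc (by linarith) ha)
  rw [functional, D.primeTerm_eq_zero_of_tsupport_subset h0 h1 hk.1.continuous hsub, archTerm,
    D.archIntegral_weilConv_weilReflect hg, weilConv_weilReflect_apply_zero]
  have hπ : ((1 / (2 * π) : ℂ)) = ((1 / (2 * π) : ℝ) : ℂ) := by push_cast; ring
  rw [hπ]
  simp only [← Complex.ofReal_mul, ← Complex.ofReal_sub, ← Complex.ofReal_add, Complex.ofReal_re,
    sub_zero]
  ring

/-- The window-positivity predicate of a datum with `Λ_f(0) = Λ_f(1) = 0` on a prime-free window is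
the non-negativity of `‖g‖₂²(log q − d log π) + (1/2π) ∫ |ĝ|² archDensity`. [cite: IwaniecKowalski2004, §5.5 Thm 5.12 (5.45)] -/
theorem positivityOn_iff_of_prime_free (h0 : D.vonMangoldt 0 = 0) (h1 : D.vonMangoldt 1 = 0)
    {a : ℝ} (ha : 2 * a ≤ Real.log 2) :
    D.PositivityOn a ↔ ∀ g : ℝ → ℂ, IsWeilTest g → tsupport g ⊆ Icc (-a) a →
      0 ≤ (∫ t : ℝ, ‖g t‖ ^ 2) * (Real.log D.conductor - D.degree * Real.log π) +
        1 / (2 * π) * ∫ t : ℝ, ‖weilMellin g (1 / 2 + t * I)‖ ^ 2 * D.archDensity t := by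
  refine forall₃_congr fun g hg hsupp ↦ ?_
  rw [D.re_functional_weilConv_weilReflect_of_tsupport_subset h0 h1 hg hsupp ha]

end WeilLDatum

/-! ## The holomorphic (weight `k`, level `N`) datum and its `Γ_ℂ` density -/

/-- The IK datum of a weight-`k` level-`N` newform with von Mangoldt coefficients `Λf`
(`Λf(p^m) = b(p^m) log p`): `d = 2`, `κ = ((k−1)/2, (k+1)/2)` (IK (5.86)), conductor `N`.
[cite: IwaniecKowalski2004, §5.11 (5.86)] -/
def weilLDatumHolomorphic (k N : ℕ) [NeZero N] (Λf : ℕ → ℂ) : WeilLDatum :=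
  ⟨2, ![((k : ℝ) - 1) / 2, ((k : ℝ) + 1) / 2], N, Nat.one_le_iff_ne_zero.2 (NeZero.ne N), Λf⟩

variable {k N : ℕ} {Λf : ℕ → ℂ}

/-- The density of the holomorphic datum: `Re ψ(k/4 + it/2) + Re ψ(k/4 + 1/2 + it/2)`.
[cite: IwaniecKowalski2004, §5.11 (5.86) with §5.1 (5.3)] -/
theorem archDensity_holomorphic (k N : ℕ) [NeZero N] (Λf : ℕ → ℂ) (t : ℝ) :
    (weilLDatumHolomorphic k N Λf).archDensity t =
      (Complex.digamma ((k : ℂ) / 4 + t / 2 * I)).re +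
        (Complex.digamma ((k : ℂ) / 4 + 1 / 2 + t / 2 * I)).re := by
  change ∑ j : Fin 2, (Complex.digamma (1 / 4 +
      (((![((k : ℝ) - 1) / 2, ((k : ℝ) + 1) / 2] : Fin 2 → ℝ) j : ℝ) : ℂ) / 2 + t / 2 * I)).re = _
  rw [Fin.sum_univ_two]
  simp only [Matrix.cons_val_zero, Matrix.cons_val_one]
  have h1 : (1 / 4 + (((((k : ℝ) - 1) / 2 : ℝ)) : ℂ) / 2 + (t : ℂ) / 2 * I) = (k : ℂ) / 4 + t / 2 * I := by
    push_cast; ring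
  have h2 : (1 / 4 + (((((k : ℝ) + 1) / 2 : ℝ)) : ℂ) / 2 + (t : ℂ) / 2 * I) =
      (k : ℂ) / 4 + 1 / 2 + t / 2 * I := by
    push_cast; ring
  rw [h1, h2]

open Literature.Analysis.SpecialFunctions.Complex in
/-- **`Γ_ℂ` form**: for `k ≥ 1`, `Re ψ(k/4 + it/2) + Re ψ(k/4 + 1/2 + it/2) = 2 Re ψ(k/2 + it) − 2 log 2`
(Legendre duplication at `s = k/4 + it/2`), i.e. with the `−2 log π` outside,
`γ′/γ + γ′/γ̄ = 2 Re ψ(k/2 + it) − 2 log 2π = 2 Re (Γ_ℂ′/Γ_ℂ)(k/2 + it)`.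
[cite: IwaniecKowalski2004, §5.11 (5.86) (c_k (2π)^{-s} Γ(s + (k-1)/2) by Legendre duplication)] -/
theorem archDensity_holomorphic_eq_GammaC [NeZero N] (hk : 1 ≤ k) (t : ℝ) :
    (weilLDatumHolomorphic k N Λf).archDensity t =
      2 * (Complex.digamma ((k : ℂ) / 2 + t * I)).re - 2 * Real.log 2 := by
  rw [archDensity_holomorphic]
  have hs : ∀ m : ℕ, 2 * ((k : ℂ) / 4 + (t : ℂ) / 2 * I) ≠ -(m : ℂ) := by
    intro m h
    have h1 := congrArg Complex.re h
    simp at h1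
    have : (1 : ℝ) ≤ k := by exact_mod_cast hk
    linarith
  have hdup := digamma_add_digamma_add_half hs
  have e1 : ((k : ℂ) / 4 + (t : ℂ) / 2 * I) + 1 / 2 = (k : ℂ) / 4 + 1 / 2 + (t : ℂ) / 2 * I := by ring
  have e2 : 2 * ((k : ℂ) / 4 + (t : ℂ) / 2 * I) = (k : ℂ) / 2 + (t : ℂ) * I := by ring
  rw [e1, e2] at hdup
  have hre := congrArg Complex.re hdup
  simp only [add_re, sub_re, mul_re, re_ofNat, im_ofNat, zero_mul, sub_zero] at hre
  have hlog2 : (Complex.log 2).re = Real.log 2 := by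
    rw [show (2 : ℂ) = ((2 : ℝ) : ℂ) by norm_num, Complex.log_ofReal_re]
  rw [hlog2] at hre
  linarith

/-! ## The printed functional (Q-GL2) -/

/-- **The Weil quadratic functional of a weight-`k`, level-`N` newform, AS PRINTED** (arXiv:1412.2990
Prop. 2.1 with `F = h = g ⋆ g̃`; the producer's (Q-GL2)):
`Q_f(g) = (log N − 2 log 2π)·h(0) + (1/π) ∫ ĥ(½+it) Re ψ(k/2 + it) dt − Σ_n n^{−1/2}(Λ_f(n) h(log n) + conj Λ_f(n) h(−log n))`
(`(1/π)∫ĥ Re ψ = (1/2π)∫ĥ·2 Re ψ`), `h = g ⋆ g̃`, `Λ_f(p^m) = b(p^m) log p` supplied as `Λf`.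
[cite: IwaniecKowalski2004, §5.5 Thm 5.12 (5.45) with §5.11 (5.86) (γ′/γ = −log 2π + ψ(s + (k−1)/2))] -/
def weilQuadraticGL2 (k N : ℕ) (Λf : ℕ → ℂ) (g : ℝ → ℂ) : ℂ :=
  (Real.log N - 2 * Real.log (2 * π) : ℝ) * weilConv g (weilReflect g) 0 +
    (1 / π : ℂ) * (∫ t : ℝ, weilMellin (weilConv g (weilReflect g)) (1 / 2 + t * I) *
      ((Complex.digamma ((k : ℂ) / 2 + t * I)).re : ℂ)) -
    (weilLDatumHolomorphic k 1 Λf).primeTerm (weilConv g (weilReflect g))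

/-- The window-positivity statement `C_f(t)` of the producer: `Re Q_f(g) ≥ 0` for all test functions
supported in `[-a, a]`. [cite: IwaniecKowalski2004, §5.5 Thm 5.12 (5.45) (positivity window, degree 2)] -/
def WeilPositivityOnGL2 (k N : ℕ) (Λf : ℕ → ℂ) (a : ℝ) : Prop :=
  ∀ g : ℝ → ℂ, IsWeilTest g → tsupport g ⊆ Icc (-a) a → 0 ≤ (weilQuadraticGL2 k N Λf g).re

/-- The prime term does not depend on the conductor slot of the datum. [folklore] -/
private theorem primeTerm_holomorphic_level (k N : ℕ) [NeZero N] (Λf : ℕ → ℂ) (h : ℝ → ℂ) :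
    (weilLDatumHolomorphic k N Λf).primeTerm h = (weilLDatumHolomorphic k 1 Λf).primeTerm h := rfl

open Literature.Analysis.SpecialFunctions.Complex in
/-- Integrability of `t ↦ ĥ(1/2+it) · Re ψ(x + it)` for a test function `h` and `x > 0` (decay of `ĥ`
against the logarithmic growth of `ψ`; the convergence of the `γ′/γ` integral in (5.45)). [cite: IwaniecKowalski2004, §5.5 Thm 5.12 (5.45) (convergence of the γ′/γ integral)] -/
theorem integrable_weilMellin_mul_re_digamma {h : ℝ → ℂ} (hh : IsWeilTest h) {x : ℝ} (hx : 0 < x) :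
    Integrable fun t : ℝ ↦ weilMellin h (1 / 2 + t * I) * ((Complex.digamma (x + t * I)).re : ℂ) := by
  obtain ⟨C, hC⟩ := exists_norm_digamma_vertical_le hx
  set F : ℝ → ℂ := fun t ↦ ((Complex.digamma (x + t * I)).re : ℂ) with hF
  have hFc : Continuous F := by
    refine continuous_ofReal.comp (Complex.continuous_re.comp ?_)
    refine continuousOn_digamma.comp_continuous (by fun_prop) fun t ↦ ?_
    simpa using hx
  have hFb : ∀ t : ℝ, ‖F t‖ ≤ C + Real.log (1 + |t|) := by
    intro t
    have h1 : ‖F t‖ ≤ ‖Complex.digamma (x + t * I)‖ := by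
      simp only [hF, Complex.norm_real, Real.norm_eq_abs]
      exact Complex.abs_re_le_norm _
    exact h1.trans (hC t)
  have hI := integrable_mul_weilMellin_vertical_of_norm_le_log hh (1 / 2) hFc hFb
  refine hI.congr (Eventually.of_forall fun t ↦ ?_)
  simp only [hF]
  push_cast
  ring

/-- **(Q-GL2) IS the IK-datum functional**: for `k ≥ 1` and every test function `g`,
`weilQuadraticGL2 k N Λf g = (weilLDatumHolomorphic k N Λf).functional (g ⋆ g̃)` — duplication for the
density and Fourier inversion `∫ ĥ(½+it) dt = 2π h(0)` to move `−2 log 2` out of the integral.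
[cite: IwaniecKowalski2004, §5.5 Thm 5.12 (5.45) with §5.11 (5.86)] -/
theorem weilQuadraticGL2_eq_functional [NeZero N] (hk : 1 ≤ k) {g : ℝ → ℂ} (hg : IsWeilTest g) :
    weilQuadraticGL2 k N Λf g = (weilLDatumHolomorphic k N Λf).functional (weilConv g (weilReflect g)) := by
  rw [weilQuadraticGL2]
  set h := weilConv g (weilReflect g) with hh_def
  have hh : IsWeilTest h := hg.weilConv hg.weilReflect
  have hk1 : (1 : ℝ) ≤ k := by exact_mod_cast hk
  -- the pieces: `A = ∫ ĥ Re ψ(k/2 + it)`, `∫ ĥ = 2π h(0)`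
  set A : ℂ := ∫ t : ℝ, weilMellin h (1 / 2 + t * I) * ((Complex.digamma ((k : ℂ) / 2 + t * I)).re : ℂ)
    with hA
  have hI1 : Integrable fun t : ℝ ↦ weilMellin h (1 / 2 + t * I) *
      ((Complex.digamma ((k : ℂ) / 2 + t * I)).re : ℂ) := by
    have := integrable_weilMellin_mul_re_digamma hh (x := (k : ℝ) / 2) (by linarith)
    refine this.congr (Eventually.of_forall fun t ↦ ?_)
    simp only [Complex.ofReal_div, Complex.ofReal_natCast, Complex.ofReal_ofNat]
  have hI2 : Integrable fun t : ℝ ↦ weilMellin h (1 / 2 + t * I) := by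
    have := integrable_weilMellin_vertical hh (1 / 2)
    refine this.congr (Eventually.of_forall fun t ↦ ?_)
    push_cast; ring_nf
  have hL : ∫ t : ℝ, weilMellin h (1 / 2 + (t : ℂ) * I) = 2 * π * h 0 := by
    have h' := integral_weilMellin_vertical hh (1 / 2)
    have e : (fun y : ℝ ↦ weilMellin h ((((1 / 2 : ℝ)) : ℂ) + y * I)) =
        fun y : ℝ ↦ weilMellin h (1 / 2 + y * I) := by
      funext y; push_cast; ring_nf
    rw [e] at h'
    exact h'
  have hdens : ∀ t : ℝ, ((weilLDatumHolomorphic k N Λf).archDensity t : ℂ) =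
      2 * ((Complex.digamma ((k : ℂ) / 2 + t * I)).re : ℂ) - 2 * (Real.log 2 : ℂ) := by
    intro t; rw [archDensity_holomorphic_eq_GammaC hk]; push_cast; ring
  have hint : (∫ t : ℝ, weilMellin h (1 / 2 + t * I) *
      ((weilLDatumHolomorphic k N Λf).archDensity t : ℂ)) = 2 * A - 2 * (Real.log 2 : ℂ) * (2 * π * h 0) := by
    have e : (fun t : ℝ ↦ weilMellin h (1 / 2 + t * I) *
        ((weilLDatumHolomorphic k N Λf).archDensity t : ℂ)) =
        fun t : ℝ ↦ 2 * (weilMellin h (1 / 2 + t * I) * ((Complex.digamma ((k : ℂ) / 2 + t * I)).re : ℂ)) -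
          (2 * (Real.log 2 : ℂ)) * weilMellin h (1 / 2 + t * I) := by
      funext t; rw [hdens t]; ring
    rw [e, integral_sub (hI1.const_mul 2) (hI2.const_mul _), integral_const_mul, integral_const_mul, hL]
  rw [WeilLDatum.functional, WeilLDatum.archTerm, hint, primeTerm_holomorphic_level k N]
  set P := (weilLDatumHolomorphic k 1 Λf).primeTerm h
  have hc : ((weilLDatumHolomorphic k N Λf).conductor : ℝ) = N := rfl
  have hd : ((weilLDatumHolomorphic k N Λf).degree : ℝ) = 2 := by
    simp [weilLDatumHolomorphic]
  rw [hc, hd]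
  have hπ : (π : ℂ) ≠ 0 := Complex.ofReal_ne_zero.2 Real.pi_ne_zero
  rw [Real.log_mul two_ne_zero Real.pi_ne_zero]
  push_cast
  field_simp
  ring

/-- Hence the producer's window statement is the datum's: `WeilPositivityOnGL2 k N Λf a ↔
(weilLDatumHolomorphic k N Λf).PositivityOn a` (`k ≥ 1`). [cite: IwaniecKowalski2004, §5.5 Thm 5.12 (5.45)] -/
theorem weilPositivityOnGL2_iff [NeZero N] (hk : 1 ≤ k) (a : ℝ) :
    WeilPositivityOnGL2 k N Λf a ↔ (weilLDatumHolomorphic k N Λf).PositivityOn a := by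
  refine forall₃_congr fun g hg _ ↦ ?_
  rw [weilQuadraticGL2_eq_functional hk hg]

/-! ## The prime-free window (P-1 STAGE 1) in closed form -/

/-- **P-1 STAGE 1 object**: for `Λf(0) = Λf(1) = 0` (every `L`-function), `supp g ⊆ [-a, a]`,
`2a ≤ log 2`:
`Re Q_f(g) = ‖g‖₂² (log N − 2 log 2π) + (1/π) ∫ |ĝ(½+it)|² Re ψ(k/2 + it) dt` — it depends on `f` only
through `(k, N)` (the lead's «one certificate per conductor»). [cite: IwaniecKowalski2004, §5.5 Thm 5.12 (5.45) (no prime power below 2)] -/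
theorem re_weilQuadraticGL2_of_tsupport_subset (h0 : Λf 0 = 0) (h1 : Λf 1 = 0) {g : ℝ → ℂ}
    (hg : IsWeilTest g) {a : ℝ} (hsupp : tsupport g ⊆ Icc (-a) a) (ha : 2 * a ≤ Real.log 2) :
    (weilQuadraticGL2 k N Λf g).re =
      (∫ t : ℝ, ‖g t‖ ^ 2) * (Real.log N - 2 * Real.log (2 * π)) +
        1 / π * ∫ t : ℝ, ‖weilMellin g (1 / 2 + t * I)‖ ^ 2 *
          (Complex.digamma ((k : ℂ) / 2 + t * I)).re := by
  have hk : IsWeilTest (weilConv g (weilReflect g)) := hg.weilConv hg.weilReflect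
  have hsub : tsupport (weilConv g (weilReflect g)) ⊆ Icc (-Real.log 2) (Real.log 2) :=
    (tsupport_weilConv_weilReflect_subset hg.2 hsupp).trans (Icc_subset_Icc (by linarith) ha)
  haveI : NeZero (1 : ℕ) := ⟨one_ne_zero⟩
  rw [weilQuadraticGL2, (weilLDatumHolomorphic k 1 Λf).primeTerm_eq_zero_of_tsupport_subset h0 h1
    hk.1.continuous hsub, weilConv_weilReflect_apply_zero]
  have hA : (∫ t : ℝ, weilMellin (weilConv g (weilReflect g)) (1 / 2 + t * I) *
      ((Complex.digamma ((k : ℂ) / 2 + t * I)).re : ℂ)) =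
      ((∫ t : ℝ, ‖weilMellin g (1 / 2 + t * I)‖ ^ 2 * (Complex.digamma ((k : ℂ) / 2 + t * I)).re : ℝ) : ℂ) := by
    rw [← integral_complex_ofReal]
    congr 1 with t
    rw [weilMellin_weilConv_weilReflect_half hg]
    push_cast; ring
  rw [hA]
  have hπ : ((1 / π : ℂ)) = ((1 / π : ℝ) : ℂ) := by push_cast; ring
  rw [hπ]
  simp only [← Complex.ofReal_mul, ← Complex.ofReal_add, Complex.ofReal_re, sub_zero]
  ring

end Literature.NumberTheory.LFunctions

end
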